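import Literature.NumberTheory.EllipticCurves.PeriodIndexCorestriction
import HarnessLib

/-!
# Corestriction from a normal open subgroup and restriction along a continuous homomorphism
(the double coset formula; Clark–Sharif 2010, §3.6, local triviality of `cores`)

Generic continuous group cohomology, continuing `PeriodIndexCorestriction` (corestriction
`coresH1 N hN : H¹(N, M) →+ H¹(G, M)` along an open subgroup `N ≤ G` of finite index, on the
tree's model `Literature.NumberTheory.EllipticCurves.discreteH1` of continuous `H¹`).  Here `N` is moreover NORMAL, and
`(φ : D →ₜ* G, ψ : M →+ M')` is a compatible pair (`ψ (φ d • m) = d • ψ m`) inducing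
`res_{(φ, ψ)} = resH1Hom φ ψ : H¹(G, M) → H¹(D, M')` (file `SubgroupSelmer`; e.g. `φ` the map
`Γ_{K_v} → Γ_K` of a completion and `ψ : E(K̄) → E(K̄_v)`, whose kernel on `H¹` is the local
condition `WeierstrassCurve.localRestrictionKer` of file `Sha`).  With `H = φ⁻¹(N) ≤ D` (open, of
finite index; `comapRestrict N φ : H →ₜ* N` the restriction of `φ`):

* `resH1Hom_coresH1_eq_sum` — the **double coset (Mackey) formula for a normal subgroup**:
  for every complete system `r : ι → G` of representatives of the `D`-orbits on `G ⧸ N`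
  (`D` acting through `φ`; the orbits are the double cosets `φ(D) \ G / N`, for `G = Γ_K`,
  `N = Γ_L`, `D = Γ_{K_v}` the places of `L` above `v`),
  `res_{(φ,ψ)} (cores θ) = Σ_i cores^D_H (res_{(φ|_H, ψ)} ((r i)_* θ))`,
  where `(r i)_* = conjH1 N M (r i)` is the conjugation action; proved on cocycles with a system
  of representatives of `G ⧸ N` adapted to the orbit decomposition
  (`G ⧸ N ≃ ι × (D ⧸ H)`, `(i, ē) ↦ φ(t ē) r_i N`), under which the transfer formula of
  `PeriodIndexCorestriction` splits orbit by orbit into the transfer formulas for `H ≤ D`;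
* `exists_orbitReps` — complete systems of orbit representatives exist;
* `resH1Hom_coresH1_eq_zero` — **corestriction preserves local triviality**: if
  `res_{(φ|_H, ψ)} (g_* θ) = 0` for all `g ∈ G` (the class `θ ∈ H¹(N, M)` is trivial at every
  place of `L` above `v`), then `res_{(φ, ψ)} (cores θ) = 0` (`cores θ` is trivial at `v`).
* `coresH1_resH1Hom_id` — corestriction commutes with an equivariant change of coefficients
  `α : M → M₂` (`cores ∘ α_* = α_* ∘ cores`; e.g. `E[P] ↪ E(K̄)`: the classes `η_i` of §3.6 are
  the images in `H¹(K, E)` of `ξ_i = cores θ_i ∈ H¹(K, E[P])`).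

The last statement is the final step of the proof of Clark–Sharif's Theorem 2 (§3.6, last
paragraph: "It remains to show that `res_v η_i = 0` for `v ∈ S_K`. Recall that
`η_i = cores Φ(π_i, 1)` or `cores Φ(π_i, π_i')`. For `w ∣ v` a place of `K_P`, the proof of
Theorem 1 showed that the curves corresponding to `Φ(π_i, 1)` and `Φ(π_i, π_i')` were trivial at
`w`. But the corestriction map induces a homomorphism `⊕_{w ∣ v} H¹((K_P)_w, E) → H¹(K_v, E)` which
proves that `η_i` is trivial at `v`."), vendored as the named fact
`Literature.NumberTheory.EllipticCurves.ClarkSharif2010_thm2` of file `PeriodIndex`.  Everything here is proved; no named fact is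
introduced.

## References

* J. Neukirch, A. Schmidt, K. Wingberg, *Cohomology of Number Fields*, 2nd ed. (2008), I.§5
  (double coset formula for `res ∘ cor`). [NeukirchSchmidtWingberg2008]
* J.-P. Serre, *Local Fields* (1979), VII.§5 and VII.§7 (Res, Cor, conjugation).
  [SerreLocalFields1979]
* P. L. Clark, S. Sharif, Algebra & Number Theory 4 (2010), §3.6 (last paragraph).
  [ClarkSharif2010]
-/

noncomputable section

open scoped Classical

universe u

namespace Literature.NumberTheory.EllipticCurves

open GaloisRepresentations

variable {G : Type u} [Group G] [TopologicalSpace G] [IsTopologicalGroup G]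
variable {D : Type u} [Group D] [TopologicalSpace D] [IsTopologicalGroup D]

/-! ## The subgroup `φ⁻¹(N) ≤ D` and the restriction `φ⁻¹(N) → N` of `φ` -/

section ComapRestrict

variable (N : Subgroup G) (φ : D →ₜ* G)

/-- The restriction `φ|_H : H = φ⁻¹(N) → N` of a continuous homomorphism `φ : D → G`, as a
continuous monoid homomorphism. Serre, *Galois Cohomology*, I.§2.4 (compatible pairs).
[folklore] -/
def comapRestrict : ↥(N.comap (φ : D →* G)) →ₜ* ↥N where
  toFun e := ⟨φ e, e.2⟩
  map_one' := Subtype.ext (map_one φ)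
  map_mul' a b := Subtype.ext (map_mul φ (a : D) (b : D))
  continuous_toFun := ((map_continuous φ).comp continuous_subtype_val).subtype_mk _

omit [IsTopologicalGroup G] [IsTopologicalGroup D] in
/-- `comapRestrict N φ e = φ e` in `G`. [folklore] -/
@[simp]
theorem comapRestrict_apply_coe (e : N.comap (φ : D →* G)) :
    ((comapRestrict N φ e : N) : G) = φ e :=
  rfl

omit [IsTopologicalGroup G] [IsTopologicalGroup D] in
/-- `φ⁻¹(N)` is open when `N` is. [folklore] -/
theorem isOpen_comap (hN : IsOpen (N : Set G)) :
    IsOpen ((N.comap (φ : D →* G) : Subgroup D) : Set D) :=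
  hN.preimage (map_continuous φ)

omit [TopologicalSpace G] [IsTopologicalGroup G] [TopologicalSpace D] [IsTopologicalGroup D] in
/-- `D ⧸ φ⁻¹(N)` injects into `G ⧸ N` (`d φ⁻¹(N) ↦ φ(d) N`). [folklore] -/
theorem quotientComapMap_injective (φ : D →* G) :
    Function.Injective
      (Quotient.map' (s₁ := QuotientGroup.leftRel (N.comap φ)) (s₂ := QuotientGroup.leftRel N) φ
        fun a b h ↦ by
          rw [QuotientGroup.leftRel_apply] at h ⊢
          simpa only [Subgroup.mem_comap, map_mul, map_inv] using h :
        D ⧸ N.comap φ → G ⧸ N) := by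
  intro a b
  induction a using QuotientGroup.induction_on with
  | H a =>
    induction b using QuotientGroup.induction_on with
    | H b =>
      intro h
      change (Quotient.mk'' (φ a) : G ⧸ N) = Quotient.mk'' (φ b) at h
      apply Quotient.sound'
      rw [QuotientGroup.leftRel_apply, Subgroup.mem_comap, map_mul, map_inv]
      exact QuotientGroup.leftRel_apply.mp (Quotient.exact' h)

omit [TopologicalSpace G] [IsTopologicalGroup G] [TopologicalSpace D] [IsTopologicalGroup D] in
/-- `D ⧸ φ⁻¹(N)` is finite when `G ⧸ N` is (so `Fintype.ofFinite (D ⧸ φ⁻¹(N))` is available).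
[folklore] -/
theorem finite_quotientComap [Finite (G ⧸ N)] (φ : D →* G) : Finite (D ⧸ N.comap φ) :=
  Finite.of_injective _ (quotientComapMap_injective N φ)

omit [TopologicalSpace G] [IsTopologicalGroup G] [TopologicalSpace D] [IsTopologicalGroup D] in
/-- `φ⁻¹(N)` has finite index in `D` when `N` has finite index in `G`. [folklore] -/
theorem finiteIndex_comap [N.FiniteIndex] (φ : D →* G) : (N.comap φ).FiniteIndex :=
  haveI := finite_quotientComap N φ
  Subgroup.finiteIndex_of_finite_quotient

omit [IsTopologicalGroup G] [IsTopologicalGroup D] in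
/-- For `N` normal, `φ(h)` acts trivially on `G ⧸ N` for `h ∈ φ⁻¹(N)`. [folklore] -/
theorem map_smul_quotient_eq [N.Normal] (h : N.comap (φ : D →* G)) (x : G ⧸ N) :
    φ h • x = x :=
  coe_smul_quotient_eq N ⟨φ h, h.2⟩ x

end ComapRestrict

/-! ## `resH1Hom` on explicit cocycles -/

section ResH1

variable {M : Type u} [AddCommGroup M] [DistribMulAction G M] [TopologicalSpace M]
  [DiscreteTopology M]
variable {M' : Type u} [AddCommGroup M'] [DistribMulAction D M'] [TopologicalSpace M']
  [DiscreteTopology M']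

/-- `res_{(φ, ψ)} [f] = [ψ ∘ f ∘ φ]`: the map `resH1Hom φ ψ h` induced by a compatible pair on
explicit cocycles (`map_oneCocycleClass`). Serre, *Galois Cohomology*, I.§2.4. [folklore] -/
theorem resH1Hom_oneCocycleClass (φ : D →ₜ* G) (ψ : M →+ M')
    (h : ∀ (x : D) (m : M), ψ (φ x • m) = x • ψ m)
    (f : contOneCocycles (discreteTopRep G M)) :
    resH1Hom φ ψ h (oneCocycleClass (discreteTopRep G M) f) =
      oneCocycleClass (discreteTopRep D M')
        (contOneCocycles.pullback φ (resHomOfEquivariant φ ψ h) f) :=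
  map_oneCocycleClass (X := discreteTopRep G M) (Y := discreteTopRep D M') φ
    (resHomOfEquivariant φ ψ h) f

omit [IsTopologicalGroup G] [IsTopologicalGroup D] in
/-- Values of the pulled-back cocycle: `(ψ ∘ f ∘ φ)(x) = ψ (f (φ x))`. [folklore] -/
theorem pullback_resHomOfEquivariant_apply (φ : D →ₜ* G) (ψ : M →+ M')
    (h : ∀ (x : D) (m : M), ψ (φ x • m) = x • ψ m)
    (f : contOneCocycles (discreteTopRep G M)) (x : D) :
    (contOneCocycles.pullback φ (resHomOfEquivariant φ ψ h) f).1 x = ψ (f.1 (φ x)) :=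
  rfl

end ResH1

/-! ## Complete systems of orbit representatives -/

section OrbitReps

variable (N : Subgroup G) (φ : D →ₜ* G)

omit [IsTopologicalGroup G] [IsTopologicalGroup D] in
/-- **Complete systems of representatives of the `D`-orbits on `G ⧸ N` exist** (`D` acting
through `φ`): a finite family `r : ι → G` such that every coset lies in the orbit of exactly one
`r i N` (the orbits are the double cosets `φ(D) \ G / N`). [folklore] -/
theorem exists_orbitReps [Fintype (G ⧸ N)] :
    ∃ (ι : Type u) (_ : Fintype ι) (r : ι → G),
      ∀ x : G ⧸ N, ∃! i, ∃ d : D, φ d • (r i : G ⧸ N) = x := by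
  letI : MulAction D (G ⧸ N) := MulAction.compHom (G ⧸ N) (φ : D →* G)
  let R := MulAction.orbitRel D (G ⧸ N)
  refine ⟨Quotient R, Quotient.fintype R, fun q ↦ q.out.out, fun x ↦ ⟨Quotient.mk R x, ?_, ?_⟩⟩
  · have h : (Quotient.mk R x).out ∈ MulAction.orbit D x :=
      MulAction.orbitRel_apply.mp (Quotient.exact (Quotient.out_eq (Quotient.mk R x)))
    obtain ⟨d, hd⟩ := MulAction.mem_orbit_iff.mp (MulAction.mem_orbit_symm.mp h)
    refine ⟨d, ?_⟩
    rw [QuotientGroup.out_eq']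
    exact hd
  · rintro j ⟨d, hd⟩
    rw [QuotientGroup.out_eq'] at hd
    have hx : x ∈ MulAction.orbit D j.out := MulAction.mem_orbit_iff.mpr ⟨d, hd⟩
    calc j = Quotient.mk R j.out := (Quotient.out_eq j).symm
      _ = Quotient.mk R x :=
        Quotient.sound (MulAction.orbitRel_apply.mpr (MulAction.mem_orbit_symm.mp hx))

end OrbitReps

/-! ## The double coset formula for a normal subgroup -/

section Mackey

variable (N : Subgroup G) [N.Normal] [Fintype (G ⧸ N)]
variable {M : Type u} [AddCommGroup M] [DistribMulAction G M] [TopologicalSpace M]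
  [DiscreteTopology M]
variable {M' : Type u} [AddCommGroup M'] [DistribMulAction D M'] [TopologicalSpace M']
  [DiscreteTopology M']
variable (φ : D →ₜ* G) (ψ : M →+ M')

omit [IsTopologicalGroup G] [IsTopologicalGroup D] [N.Normal] [Fintype (G ⧸ N)]
  [TopologicalSpace M] [DiscreteTopology M] [TopologicalSpace M'] [DiscreteTopology M'] in
/-- The restricted pair `(φ|_H : H → N, ψ)` is compatible when `(φ, ψ)` is. [folklore] -/
theorem smul_compat_comapRestrict (hψ : ∀ (d : D) (m : M), ψ (φ d • m) = d • ψ m)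
    (e : N.comap (φ : D →* G)) (m : M) : ψ (comapRestrict N φ e • m) = e • ψ m :=
  hψ e m

variable {N φ} in
omit [IsTopologicalGroup G] [IsTopologicalGroup D] [Fintype (G ⧸ N)] in
/-- The orbit map `(i, ē) ↦ φ(t ē) • r_i N` of a complete system of orbit representatives `r`
and a system `t` of representatives of `D ⧸ φ⁻¹(N)` is a bijection `ι × (D ⧸ φ⁻¹(N)) → G ⧸ N`
(for `N` normal the stabiliser in `D` of every coset is `φ⁻¹(N)`). [folklore] -/
theorem orbitMap_bijective {ι : Type*} {r : ι → G}
    (hr : ∀ x : G ⧸ N, ∃! i, ∃ d : D, φ d • (r i : G ⧸ N) = x)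
    {t : D ⧸ N.comap (φ : D →* G) → D} (ht : ∀ ē, (t ē : D ⧸ N.comap (φ : D →* G)) = ē) :
    Function.Bijective fun p : ι × (D ⧸ N.comap (φ : D →* G)) ↦ φ (t p.2) • (r p.1 : G ⧸ N) := by
  constructor
  · rintro ⟨i, a⟩ ⟨j, b⟩ hij
    simp only at hij
    obtain rfl : i = j :=
      (hr (φ (t a) • (r i : G ⧸ N))).unique ⟨t a, rfl⟩ ⟨t b, hij.symm⟩
    simp only [Prod.mk.injEq, true_and]
    -- `φ(t a) r_i N = φ(t b) r_i N` gives `φ((t a)⁻¹ t b) ∈ r_i N r_i⁻¹ = N`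
    rw [MulAction.Quotient.smul_coe, MulAction.Quotient.smul_coe, smul_eq_mul, smul_eq_mul,
      QuotientGroup.eq] at hij
    have hmem : φ ((t a)⁻¹ * t b) ∈ N := by
      have h' := ‹N.Normal›.conj_mem _ hij (r i)
      rw [map_mul, map_inv]
      convert h' using 1
      group
    rw [← ht a, ← ht b]
    exact QuotientGroup.eq.mpr hmem
  · intro x
    obtain ⟨i, ⟨d, hd⟩, -⟩ := hr x
    refine ⟨(i, (d : D ⧸ N.comap (φ : D →* G))), ?_⟩
    simp only
    -- `t d̄ = d h` with `h ∈ φ⁻¹(N)`, and `φ(h)` acts trivially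
    have hmem : (t (d : D ⧸ N.comap (φ : D →* G)))⁻¹ * d ∈ N.comap (φ : D →* G) :=
      QuotientGroup.eq.mp (ht _)
    have e : φ d = φ (t (d : D ⧸ N.comap (φ : D →* G))) *
        φ ((t (d : D ⧸ N.comap (φ : D →* G)))⁻¹ * d) := by
      rw [← map_mul, mul_inv_cancel_left]
    rw [← hd, e, mul_smul]
    congr 1
    exact (map_smul_quotient_eq N φ ⟨_, hmem⟩ _).symm

variable {N φ} in
omit [IsTopologicalGroup G] [IsTopologicalGroup D] [Fintype (G ⧸ N)] in
/-- **Representatives of `G ⧸ N` adapted to the orbit decomposition**: with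
`e : ι × (D ⧸ H) ≃ G ⧸ N` the orbit map, `s(e(i, ē)) = φ(t ē) r_i` is a system of
representatives with `s(φ(d) • e(i, ē)) = φ(t(d • ē)) r_i`. [folklore] -/
theorem exists_adaptedSection {ι : Type*} {r : ι → G}
    (hr : ∀ x : G ⧸ N, ∃! i, ∃ d : D, φ d • (r i : G ⧸ N) = x)
    {t : D ⧸ N.comap (φ : D →* G) → D} (ht : ∀ ē, (t ē : D ⧸ N.comap (φ : D →* G)) = ē) :
    ∃ (e : ι × (D ⧸ N.comap (φ : D →* G)) ≃ G ⧸ N) (s : G ⧸ N → G),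
      (∀ p, e p = φ (t p.2) • (r p.1 : G ⧸ N)) ∧ (∀ x, (s x : G ⧸ N) = x) ∧
        ∀ (d : D) (i : ι) (ē : D ⧸ N.comap (φ : D →* G)),
          s (φ d • e (i, ē)) = φ (t (d • ē)) * r i := by
  obtain ⟨e, he⟩ : ∃ e : ι × (D ⧸ N.comap (φ : D →* G)) ≃ G ⧸ N,
      ∀ p, e p = φ (t p.2) • (r p.1 : G ⧸ N) :=
    ⟨Equiv.ofBijective _ (orbitMap_bijective hr ht), fun _ ↦ rfl⟩
  -- `φ(d) • e(i, ē) = e(i, d • ē)`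
  have hsmul : ∀ (d : D) (i : ι) (ē : D ⧸ N.comap (φ : D →* G)),
      φ d • e (i, ē) = e (i, d • ē) := fun d i ē ↦ by
    rw [he, he]
    change φ d • φ (t ē) • (r i : G ⧸ N) = φ (t (d • ē)) • (r i : G ⧸ N)
    rw [smul_smul, ← map_mul, ← rep_mul_schreierElt (N.comap (φ : D →* G)) ht d ē, map_mul,
      mul_smul]
    congr 1
    exact map_smul_quotient_eq N φ _ _
  refine ⟨e, fun x ↦ φ (t (e.symm x).2) * r (e.symm x).1, he, fun x ↦ ?_, fun d i ē ↦ ?_⟩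
  · change ((φ (t (e.symm x).2) * r (e.symm x).1 : G) : G ⧸ N) = x
    rw [← smul_eq_mul, ← MulAction.Quotient.smul_coe, ← he, Equiv.apply_symm_apply]
  · change φ (t (e.symm (φ d • e (i, ē))).2) * r (e.symm (φ d • e (i, ē))).1 = _
    rw [hsmul, Equiv.symm_apply_apply]

variable {N φ ψ} in
/-- **The double coset formula on cocycles.** With representatives `s` of `G ⧸ N` adapted to the
orbit decomposition (`exists_adaptedSection`), the pull-back along `(φ, ψ)` of the transfer of
`f` is the sum over the orbit representatives `r i` of the transfers, from `φ⁻¹(N)` to `D`, of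
the pull-backs along `(φ|_{φ⁻¹(N)}, ψ)` of the conjugates `(r i) · f`: for `d ∈ D` and
`x = e(i, ē)`, `s(φ(d) • x)⁻¹ φ(d) s(x) = r_i⁻¹ φ(t(d • ē)⁻¹ d t(ē)) r_i`.
Neukirch–Schmidt–Wingberg, I.§5. [folklore] -/
theorem pullback_coresCocycle_eq_sum (hψ : ∀ (d : D) (m : M), ψ (φ d • m) = d • ψ m)
    (hN : IsOpen (N : Set G)) [Fintype (D ⧸ N.comap (φ : D →* G))] {ι : Type*} [Fintype ι]
    {r : ι → G} {t : D ⧸ N.comap (φ : D →* G) → D}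
    (ht : ∀ ē, (t ē : D ⧸ N.comap (φ : D →* G)) = ē)
    {e : ι × (D ⧸ N.comap (φ : D →* G)) ≃ G ⧸ N} {s : G ⧸ N → G}
    (hs : ∀ x, (s x : G ⧸ N) = x)
    (hsd : ∀ (d : D) (i : ι) (ē : D ⧸ N.comap (φ : D →* G)),
      s (φ d • e (i, ē)) = φ (t (d • ē)) * r i)
    (f : contOneCocycles (discreteTopRep N M)) :
    contOneCocycles.pullback φ (resHomOfEquivariant φ ψ hψ) (coresCocycle N hN hs f) =
      ∑ i, coresCocycle (N.comap (φ : D →* G)) (isOpen_comap N φ hN) ht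
        (contOneCocycles.pullback (comapRestrict N φ)
          (resHomOfEquivariant (comapRestrict N φ) ψ (smul_compat_comapRestrict N φ ψ hψ))
          (conjCocycle N (r i) f)) := by
  apply Subtype.ext
  ext d
  rw [pullback_resHomOfEquivariant_apply, coresCocycle_apply, coresFun_apply, map_sum,
    sum_apply_val]
  have hre : ∑ x : G ⧸ N, ψ (s (φ d • x) • f.1 (schreierElt N hs (φ d) x)) =
      ∑ p : ι × (D ⧸ N.comap (φ : D →* G)),
        ψ (s (φ d • e p) • f.1 (schreierElt N hs (φ d) (e p))) :=
    (Equiv.sum_comp e (fun x ↦ ψ (s (φ d • x) • f.1 (schreierElt N hs (φ d) x)))).symm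
  rw [hre, Fintype.sum_prod_type]
  refine Finset.sum_congr rfl fun i _ ↦ ?_
  rw [coresCocycle_apply, coresFun_apply]
  refine Finset.sum_congr rfl fun ē _ ↦ ?_
  -- `s(e(i, ē)) = φ(t ē) r_i`
  have h1 : s (e (i, ē)) = φ (t ē) * r i := by
    have h := hsd 1 i ē
    rwa [map_one, one_smul, one_smul] at h
  -- the Schreier element of `G` at `(φ d, e(i, ē))` is `r_i⁻¹ φ(schreierElt_D d ē) r_i`
  have hS : schreierElt N hs (φ d) (e (i, ē)) = subgroupConj N (r i)
      (comapRestrict N φ (schreierElt (N.comap (φ : D →* G)) ht d ē)) := by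
    apply Subtype.ext
    rw [schreierElt_coe, hsd, h1, subgroupConj_apply_coe, comapRestrict_apply_coe,
      schreierElt_coe, map_mul, map_mul, map_inv]
    group
  rw [hS, pullback_resHomOfEquivariant_apply, conjCocycle_apply, hsd, mul_smul, hψ]

/-- **The double coset (Mackey) formula for a normal open subgroup of finite index.** For a
compatible pair `(φ : D → G, ψ : M → M')`, `H = φ⁻¹(N)`, and a complete system `r : ι → G` of
representatives of the `D`-orbits on `G ⧸ N` (the double cosets `φ(D) \\ G / N`):
`res_{(φ, ψ)} (cores^G_N θ) = Σ_i cores^D_H (res_{(φ|_H, ψ)} ((r i)_* θ))` in `H¹(D, M')`, where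
`(r i)_* θ = conjH1 N M (r i) θ`. For `G = Γ_K`, `N = Γ_L` (`L/K` finite Galois), `D = Γ_{K_v}`:
`res_v ∘ cores_{L/K} = Σ_{w ∣ v} cores_{L_w/K_v} ∘ res_w` on `H¹(L, M)`.
Neukirch–Schmidt–Wingberg, I.§5 (double coset formula); Serre, *Local Fields*, VII.§5–§7.
[folklore] -/
theorem resH1Hom_coresH1_eq_sum (hψ : ∀ (d : D) (m : M), ψ (φ d • m) = d • ψ m)
    (hN : IsOpen (N : Set G)) [Fintype (D ⧸ N.comap (φ : D →* G))] {ι : Type*} [Fintype ι]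
    (r : ι → G) (hr : ∀ x : G ⧸ N, ∃! i, ∃ d : D, φ d • (r i : G ⧸ N) = x)
    (θ : subgroupH1 N M) :
    resH1Hom φ ψ hψ (coresH1 N hN θ) =
      ∑ i, coresH1 (N.comap (φ : D →* G)) (isOpen_comap N φ hN)
        (resH1Hom (comapRestrict N φ) ψ (smul_compat_comapRestrict N φ ψ hψ)
          (conjH1 N M (r i) θ)) := by
  obtain ⟨f, rfl⟩ := oneCocycleClass_surjective _ θ
  have ht : ∀ ē : D ⧸ N.comap (φ : D →* G),
      ((Quotient.out ē : D) : D ⧸ N.comap (φ : D →* G)) = ē :=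
    QuotientGroup.out_eq'
  obtain ⟨e, s, -, hs, hsd⟩ := exists_adaptedSection hr ht
  rw [coresH1_oneCocycleClass N hN hs, resH1Hom_oneCocycleClass,
    pullback_coresCocycle_eq_sum hψ hN ht hs hsd f, ← oneCocycleClassₗ_apply, map_sum]
  refine Finset.sum_congr rfl fun i _ ↦ ?_
  rw [oneCocycleClassₗ_apply, conjH1_oneCocycleClass, resH1Hom_oneCocycleClass,
    coresH1_oneCocycleClass _ _ ht]

/-- **Corestriction preserves local triviality** (Clark–Sharif 2010, §3.6, last paragraph: "the
corestriction map induces a homomorphism `⊕_{w ∣ v} H¹((K_P)_w, E) → H¹(K_v, E)` which proves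
that `η_i` is trivial at `v`"). For a normal open subgroup `N` of finite index, a compatible pair
`(φ : D → G, ψ : M → M')` and `θ ∈ H¹(N, M)`: if `res_{(φ|_{φ⁻¹(N)}, ψ)} (g_* θ) = 0` for every
`g ∈ G` (`θ` is trivial at every place above `v`), then `res_{(φ, ψ)} (cores θ) = 0`.
[cite: ClarkSharif2010, §3.6 (last paragraph)] -/
theorem resH1Hom_coresH1_eq_zero (hψ : ∀ (d : D) (m : M), ψ (φ d • m) = d • ψ m)
    (hN : IsOpen (N : Set G)) [Fintype (D ⧸ N.comap (φ : D →* G))] (θ : subgroupH1 N M)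
    (hθ : ∀ g : G, resH1Hom (comapRestrict N φ) ψ (smul_compat_comapRestrict N φ ψ hψ)
      (conjH1 N M g θ) = 0) :
    resH1Hom φ ψ hψ (coresH1 N hN θ) = 0 := by
  obtain ⟨ι, _, r, hr⟩ := exists_orbitReps N φ
  rw [resH1Hom_coresH1_eq_sum N φ ψ hψ hN r hr θ]
  exact Finset.sum_eq_zero fun i _ ↦ by rw [hθ, map_zero]

end Mackey

/-! ## Corestriction and change of coefficients -/

section Coefficients

variable (N : Subgroup G) [Fintype (G ⧸ N)] {s : G ⧸ N → G}
variable {M : Type u} [AddCommGroup M] [DistribMulAction G M] [TopologicalSpace M]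
  [DiscreteTopology M]
variable {M₂ : Type u} [AddCommGroup M₂] [DistribMulAction G M₂] [TopologicalSpace M₂]
  [DiscreteTopology M₂]
variable (α : M →+ M₂)

omit [IsTopologicalGroup G] [Fintype (G ⧸ N)] [TopologicalSpace M] [DiscreteTopology M]
  [TopologicalSpace M₂] [DiscreteTopology M₂] in
/-- A `G`-equivariant map of coefficients is `N`-equivariant (the compatible pair `(id_N, α)`).
[folklore] -/
theorem smul_compat_subgroup (hα : ∀ (g : G) (m : M), α (g • m) = g • α m) (n : N) (m : M) :
    α (ContinuousMonoidHom.id N n • m) = n • α m :=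
  hα n m

omit [IsTopologicalGroup G] in
/-- On cocycles, the transfer commutes with an equivariant change of coefficients:
`cor (α ∘ f) = α ∘ cor f`. [folklore] -/
theorem coresFun_pullback_id (hα : ∀ (g : G) (m : M), α (g • m) = g • α m)
    (hs : ∀ x : G ⧸ N, (s x : G ⧸ N) = x) (f : contOneCocycles (discreteTopRep N M)) (g : G) :
    coresFun N hs (contOneCocycles.pullback (ContinuousMonoidHom.id N)
        (resHomOfEquivariant (ContinuousMonoidHom.id N) α (smul_compat_subgroup N α hα)) f) g =
      α (coresFun N hs f g) := by
  rw [coresFun_apply, coresFun_apply, map_sum]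
  refine Finset.sum_congr rfl fun x _ ↦ ?_
  rw [hα]
  rfl

/-- **Corestriction commutes with an equivariant change of coefficients** `α : M → M₂`
(`α (g • m) = g • α m`): `cores ∘ α_* = α_* ∘ cores` as maps `H¹(N, M) → H¹(G, M₂)`, where
`α_* = resH1Hom id α` (e.g. `α` the inclusion `E[P] ↪ E(K̄)`: the corestriction of the image
of `θ ∈ H¹(K_P, E[P])` in `H¹(K_P, E)` is the image of `cores θ` in `H¹(K, E)`, as used in
Clark–Sharif §3.6 for `η_i`, the image of `ξ_i = cores θ_i`). Serre, *Galois Cohomology*,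
I.§2.4 (functoriality in compatible pairs). [folklore] -/
theorem coresH1_resH1Hom_id (hα : ∀ (g : G) (m : M), α (g • m) = g • α m)
    (hN : IsOpen (N : Set G)) (θ : subgroupH1 N M) :
    coresH1 N hN (resH1Hom (ContinuousMonoidHom.id N) α (smul_compat_subgroup N α hα) θ) =
      resH1Hom (ContinuousMonoidHom.id G) α hα (coresH1 N hN θ) := by
  obtain ⟨f, rfl⟩ := oneCocycleClass_surjective _ θ
  have hs : ∀ x : G ⧸ N, ((Quotient.out x : G) : G ⧸ N) = x := QuotientGroup.out_eq'
  rw [resH1Hom_oneCocycleClass, coresH1_oneCocycleClass N hN hs, coresH1_oneCocycleClass N hN hs,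
    resH1Hom_oneCocycleClass]
  congr 1
  apply Subtype.ext
  ext g
  rw [coresCocycle_apply, coresFun_pullback_id N α hα hs f g]
  rfl

end Coefficients

end Literature.NumberTheory.EllipticCurves

end
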